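import Mathlib
import Summits.PneNP.PneNP.Theorems.ConvexRankGatesConvexGateBlindAffinePencil

/-!
# PneNP / ConvexRankGates — `ConvexGateBlind`: the Euclidean length of a coordinate vector (dot-product form)

Helpers (`--supports stmt-PneNP-10680`), COLUMN-SPACE line (prover seat 2, session 26), PSD side. The exclusion
constructions are second-order-cone maps `u ↦ (a(u); b(u))` with `b(u) : Fin d → ℝ`, and the arrow dictionary
(`…AffinePencilArrow.lean`) wants `Σ bᵢ² ≤ a²`; the estimates in between are triangle inequalities. This file is the
small bridge: `dotNorm v = √⟨v,v⟩` on `Fin d → ℝ` with Cauchy–Schwarz (`dotProduct_le_dotNorm_mul_dotNorm`), the triangle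
inequality (`dotNorm_add_le`, `dotNorm_sum_le`), scaling (`dotNorm_smul_of_nonneg`), unit vectors (`dotNorm_eq_one_of_unit`),
the cone test in both directions (`sum_sq_le_sq_of_dotNorm_le`, `dotProduct_self_le_sq_of_dotNorm_le`) and the lower bound
`⟨b,p⟩² ≤ ⟨b,b⟩` for unit `p` (`dotProduct_unit_sq_le`, `sq_lt_sum_sq_of_lt_dotProduct_unit`). [folklore]
-/

set_option linter.dupNamespace false

namespace Summit.PneNP.PneNP.Theorems

open Finset Real Matrix

noncomputable section

variable {d : ℕ}

/-- The Euclidean length `√⟨v, v⟩` of a coordinate vector. [folklore] -/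
def dotNorm (v : Fin d → ℝ) : ℝ := Real.sqrt (v ⬝ᵥ v)

/-- `dotNorm v ≥ 0`. [folklore] -/
theorem dotNorm_nonneg (v : Fin d → ℝ) : 0 ≤ dotNorm v := Real.sqrt_nonneg _

/-- `dotNorm v ^ 2 = ⟨v, v⟩`. [folklore] -/
theorem dotNorm_sq (v : Fin d → ℝ) : dotNorm v ^ 2 = v ⬝ᵥ v := by
  rw [dotNorm, Real.sq_sqrt (by rw [dotProduct]; exact Finset.sum_nonneg fun i _ => mul_self_nonneg _)]

/-- `⟨v, v⟩ = Σ vᵢ²`. [folklore] -/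
theorem dotProduct_self_eq_sum_sq (v : Fin d → ℝ) : v ⬝ᵥ v = ∑ i, v i ^ 2 := by
  rw [dotProduct]; exact Finset.sum_congr rfl fun i _ => by ring

/-- **Cauchy–Schwarz**: `⟨v, w⟩ ≤ ‖v‖‖w‖`. [folklore] -/
theorem dotProduct_le_dotNorm_mul_dotNorm (v w : Fin d → ℝ) : v ⬝ᵥ w ≤ dotNorm v * dotNorm w := by
  have hcs : (v ⬝ᵥ w) ^ 2 ≤ (v ⬝ᵥ v) * (w ⬝ᵥ w) := by
    have h := Finset.sum_mul_sq_le_sq_mul_sq (Finset.univ : Finset (Fin d)) v w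
    rw [dotProduct_self_eq_sum_sq, dotProduct_self_eq_sum_sq]
    simpa [dotProduct] using h
  have h2 : (v ⬝ᵥ w) ^ 2 ≤ (dotNorm v * dotNorm w) ^ 2 := by
    rw [mul_pow, dotNorm_sq, dotNorm_sq]; exact hcs
  have := abs_le_of_sq_le_sq' h2 (mul_nonneg (dotNorm_nonneg v) (dotNorm_nonneg w))
  exact this.2

/-- **Triangle inequality.** [folklore] -/
theorem dotNorm_add_le (v w : Fin d → ℝ) : dotNorm (v + w) ≤ dotNorm v + dotNorm w := by
  have hsq : dotNorm (v + w) ^ 2 ≤ (dotNorm v + dotNorm w) ^ 2 := by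
    rw [dotNorm_sq, add_sq, dotNorm_sq, dotNorm_sq, add_dotProduct, dotProduct_add, dotProduct_add,
      dotProduct_comm w v]
    nlinarith [dotProduct_le_dotNorm_mul_dotNorm v w]
  exact pow_le_pow_iff_left₀ (dotNorm_nonneg _) (add_nonneg (dotNorm_nonneg v) (dotNorm_nonneg w)) two_ne_zero |>.1 hsq

/-- `dotNorm 0 = 0`. [folklore] -/
theorem dotNorm_zero : dotNorm (0 : Fin d → ℝ) = 0 := by
  simp [dotNorm]

/-- **Triangle inequality for sums.** [folklore] -/
theorem dotNorm_sum_le {ι : Type*} (s : Finset ι) (f : ι → Fin d → ℝ) :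
    dotNorm (∑ i ∈ s, f i) ≤ ∑ i ∈ s, dotNorm (f i) := by
  classical
  induction s using Finset.induction_on with
  | empty => simp [dotNorm_zero]
  | insert x s hx ih =>
    rw [Finset.sum_insert hx, Finset.sum_insert hx]
    exact (dotNorm_add_le _ _).trans (by linarith)

/-- **Scaling by a non-negative factor.** [folklore] -/
theorem dotNorm_smul_of_nonneg {c : ℝ} (hc : 0 ≤ c) (v : Fin d → ℝ) : dotNorm (c • v) = c * dotNorm v := by
  rw [dotNorm, smul_dotProduct, dotProduct_smul, smul_eq_mul, smul_eq_mul, ← mul_assoc,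
    show c * c * (v ⬝ᵥ v) = (c * c) * (v ⬝ᵥ v) from rfl, Real.sqrt_mul (mul_self_nonneg c), Real.sqrt_mul_self hc, dotNorm]

/-- A unit vector has length `1`. [folklore] -/
theorem dotNorm_eq_one_of_unit {p : Fin d → ℝ} (hp : p ⬝ᵥ p = 1) : dotNorm p = 1 := by
  rw [dotNorm, hp, Real.sqrt_one]

/-- **Into the cone**: `dotNorm b ≤ a` gives `Σ bᵢ² ≤ a²` (the hypothesis of `arrow_posSemidef`). [folklore] -/
theorem sum_sq_le_sq_of_dotNorm_le {b : Fin d → ℝ} {a : ℝ} (h : dotNorm b ≤ a) : ∑ i, b i ^ 2 ≤ a ^ 2 := by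
  rw [← dotProduct_self_eq_sum_sq, ← dotNorm_sq]
  exact pow_le_pow_left₀ (dotNorm_nonneg b) h 2

/-- `dotNorm b ≤ a` gives `⟨b, b⟩ ≤ a²`. [folklore] -/
theorem dotProduct_self_le_sq_of_dotNorm_le {b : Fin d → ℝ} {a : ℝ} (h : dotNorm b ≤ a) : b ⬝ᵥ b ≤ a ^ 2 := by
  rw [dotProduct_self_eq_sum_sq]; exact sum_sq_le_sq_of_dotNorm_le h

/-- `⟨b, b⟩ ≤ A²` with `0 ≤ A` gives `dotNorm b ≤ A`. [folklore] -/
theorem dotNorm_le_of_dotProduct_self_le_sq {b : Fin d → ℝ} {A : ℝ} (hA : 0 ≤ A) (h : b ⬝ᵥ b ≤ A ^ 2) :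
    dotNorm b ≤ A := by
  rw [dotNorm, ← Real.sqrt_sq hA]
  exact Real.sqrt_le_sqrt h

/-- **Lower bound along a unit direction**: `⟨b, p⟩ ≤ dotNorm b` for unit `p`; in squared form
`⟨b, p⟩² ≤ ⟨b, b⟩`. [folklore] -/
theorem dotProduct_unit_sq_le {p : Fin d → ℝ} (hp : p ⬝ᵥ p = 1) (b : Fin d → ℝ) : (b ⬝ᵥ p) ^ 2 ≤ b ⬝ᵥ b := by
  have h := dotProduct_le_dotNorm_mul_dotNorm b p
  have h' := dotProduct_le_dotNorm_mul_dotNorm (-b) p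
  have hn : dotNorm (-b) = dotNorm b := by simp [dotNorm]
  rw [neg_dotProduct, hn] at h'
  rw [dotNorm_eq_one_of_unit hp, mul_one] at h h'
  have := sq_le_sq' (by linarith) h
  rw [dotNorm_sq] at this
  exact this

/-- **Outside the cone along a direction**: if `0 ≤ a < ⟨b, p⟩` for a unit `p` then `a² < Σ bᵢ²` (the hypothesis of
`arrow_not_posSemidef_of_sq_lt`). [folklore] -/
theorem sq_lt_sum_sq_of_lt_dotProduct_unit {p b : Fin d → ℝ} (hp : p ⬝ᵥ p = 1) {a : ℝ} (ha : 0 ≤ a)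
    (h : a < b ⬝ᵥ p) : a ^ 2 < ∑ i, b i ^ 2 := by
  rw [← dotProduct_self_eq_sum_sq]
  have h1 : a ^ 2 < (b ⬝ᵥ p) ^ 2 := by nlinarith
  exact h1.trans_le (dotProduct_unit_sq_le hp b)

/-- **The norm toolkit** (registered form): Cauchy–Schwarz and the triangle inequality for `dotNorm v = √⟨v,v⟩` on
`Fin d → ℝ`. [folklore] -/
theorem dotNorm_toolkit : ∀ {d : ℕ} (v w : Fin d → ℝ), v ⬝ᵥ w ≤ dotNorm v * dotNorm w ∧ dotNorm (v + w) ≤ dotNorm v + dotNorm w :=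
  fun v w => ⟨dotProduct_le_dotNorm_mul_dotNorm v w, dotNorm_add_le v w⟩

end

end Summit.PneNP.PneNP.Theorems
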